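import Summits.QuantumFields.YangMills.Theorems.BalabanUVNodesN06DivLegAtPinsPhys
import Literature.MathematicalPhysics.QuantumFieldTheory.Balaban1983to89.B9OpsRTransportSectD

/-!
# BalabanUVNodes ∕ N06 ([B9], `Dag.B9_main`) — CASCADE-R STEP 3: THE R-GENERIC TWIN of `N06DivLegAtPinsPhys.hdivDs_of_pins` (rows 20–21's `D*G₀∇*` leg `hdivDs`),
# re-typed over the CLASS-PARAMETRIC member background `bg9YR 𝔸 G R₁ R₂` (objects AND premises), the Y-class content ONE displayed hypothesis

Track A of `YM-PLAN.md` (cell `pub-ymgap`, D-0062), node **N06** = [Balaban1985BackgroundPropagators] Thms 3.1–3.15; seat `pub-ymgap-dag-n06-d` (gen 13).  WHY: node00-def-Y g23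
RULING-2 (I.39588), road (α1), on this seat's STEP-3 FACE CENSUS (I.39391): `hdivDs_of_pins` is «`bg9Y`-PINNED ✗, c-GENERIC» (rule (b): object re-typing).  Its content is
dag-n06-w5's `B9Thm33G0DivRAtPins.h44Ds_pins` — an Ops-TYPED Y-face reading the (3.35) class of `U` — consumed UNCHANGED at the fieldwise re-typings `ops312RY (𝔬12 x)`,
`holderProbesRY (𝔭A x)` of node00-def-Y's `B9OpsRTransport` (p648903; dag-n06-w7 OFFER-1 road (B)); the G₀-layer input `h33 : Thm33G0Dir (𝔬12 x) …` (R-typed) is carried over by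
node00-def-Y's bridge `B9OpsRTransportSectD.thm33G0Dir_iff`; per RULING-2 (c) the class-content read is ONE displayed hypothesis `hY335 : (bg9YR …).Reg335 c35 α₀ U → (bg9Y …).Reg335 c35 α₀ U`
(at the Y-closer `id`; at the P-closer dag-n06-j's bridge `regY335_of_regYP335` with `c35 := c35B ℓ`).
★★ `hdivDs_of_pinsR` — `hdivDs_of_pins` with `bg9Y … x ↦ bg9YR … R₁ R₂ x` in every object and premise, `+ hY335`; same closed witnesses `MD := max M₀ M_L`, `BiD ε`.
HONEST FRAMING.  Mechanical re-typing + one transport; the estimate is dag-n06-w5's kernel-checked theorem; nothing of [B9] asserted beyond it; COUNT-NEUTRAL; N06 NOT discharged;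
K1⁹ NOT closed; one finite 𝕋⁴ programme at fixed `ε` — NOT continuum ∕ OS ∕ mass gap ∕ Clay.  0 `def`, 0 `sorry`.
-/

noncomputable section

namespace Summit.QuantumFields.YangMills.BalabanUVNodes.N06DivLegAtPinsPhysR

open Literature.MathematicalPhysics.QuantumFieldTheory.Balaban1983to89
open Literature.MathematicalPhysics.QuantumFieldTheory.Balaban1983to89.Node00 (FBondY IBondY)
open Literature.MathematicalPhysics.QuantumFieldTheory.Balaban1983to89.B9Thm34Ext (toB6)
open Literature.MathematicalPhysics.QuantumFieldTheory.Balaban1983to89.B11SectG (HasMaj BlockNorm RowSum)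
open Literature.MathematicalPhysics.QuantumFieldTheory.Balaban1983to89.B9Thm312WholeClasses (cNormR)
open Literature.MathematicalPhysics.QuantumFieldTheory.Balaban1983to89.B9RWSums343Holder (HolderProbes)
open Literature.MathematicalPhysics.QuantumFieldTheory.Balaban1983to89.B9Thm312WholeDir (Thm33G0Dir)
open Literature.MathematicalPhysics.QuantumFieldTheory.Balaban1983to89.B9CoReadingCoords (coordOpK XBK blkBK cdBₗ)
open Literature.MathematicalPhysics.QuantumFieldTheory.Balaban1983to89.B9CoReadingCoordsS (XSK blkSK sIK)
open Literature.MathematicalPhysics.QuantumFieldTheory.Balaban1983to89.B9CoReadingCoordsH (XHK)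
open Literature.MathematicalPhysics.QuantumFieldTheory.Balaban1983to89.B9CoReadingCoordsInput (bHK)
open Literature.MathematicalPhysics.QuantumFieldTheory.Balaban1983to89.B9CoRealizesRelAtLetters (RelB)
open Literature.MathematicalPhysics.QuantumFieldTheory.Balaban1983to89.B9CoReadingCoordsTranspose (TrIdx trBasis)
open Literature.MathematicalPhysics.QuantumFieldTheory.Balaban1983to89.B9Thm39ReadingCoords (cR39 cR39_nonneg)
open Literature.MathematicalPhysics.QuantumFieldTheory.Balaban1983to89.B9Thm33G0DivRAtPins (h44Ds_pins)
open Literature.MathematicalPhysics.QuantumFieldTheory.Balaban1983to89.B9PinMembersKLevelV1 (MemberY geo9Y bg9Y)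
open Literature.MathematicalPhysics.QuantumFieldTheory.Balaban1983to89.B9BackgroundsKLevelV1R (RegFamY bg9YR)
open Literature.MathematicalPhysics.QuantumFieldTheory.Balaban1983to89.B9OpsRTransport (ops312RY holderProbesRY)
open Literature.MathematicalPhysics.QuantumFieldTheory.Balaban1983to89.B9OpsRTransportSectD (thm33G0Dir_iff)
open Literature.MathematicalPhysics.QuantumFieldTheory.Balaban1983to89.B9GeoLemma21KLevelV1 (geo9Y_len_pos rowSum261_geo9Y)
open Literature.MathematicalPhysics.QuantumFieldTheory.Balaban1983to89.B9GradViaDivLettersAtPins (rJ)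
open Literature.MathematicalPhysics.QuantumFieldTheory.Balaban1983to89.Node00.OpsYSectDCoords (DvscoKH)
open Literature.MathematicalPhysics.QuantumFieldTheory.Balaban1983to89.B7Prop2SpecialUnitary (specialUnitaryUnits)
open Literature.MathematicalPhysics.QuantumFieldTheory.Balaban1983to89.B6GlobalChartV1 (blkV1)
open Literature.MathematicalPhysics.QuantumFieldTheory.Balaban1983to89.B6Ineq2142KLevelV1 (β)
open Literature.MathematicalPhysics.QuantumFieldTheory.Balaban1983to89.B6Geom246MultiLevelTorus (geomT)
open scoped Matrix.Norms.L2Operator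

variable {d ℓ : ℕ} {hd : 1 ≤ d + 1} {hL : Odd (ℓ + 1) ∧ 1 < ℓ + 1} {b₀ b₁ : ℝ} {Mstar : ℕ} {N : ℕ} [NeZero N]
variable [∀ x : MemberY d ℓ hd hL b₀ b₁ Mstar, Fintype (geo9Y x).Site] [∀ x : MemberY d ℓ hd hL b₀ b₁ Mstar, DecidableRel (RelB x.toKIdx)]

/-- ★★ **`hdiv.h44Ds` AT THE MEMBERS, R-GENERIC** (module docstring): `N06DivLegAtPinsPhys.hdivDs_of_pins` over `bg9YR … R₁ R₂ x`, dag-n06-w5's `h44Ds_pins` fed through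
`ops312RY ∕ holderProbesRY ∕ thm33G0Dir_iff` and the displayed class inclusion `hY335`.
[cite: Balaban1985BackgroundPropagators, Thm 3.3 (3.44) p.398 + (3.8) p.392 + (3.35)–(3.36) p.396 + Thm 3.12 pp.421–423; Balaban1984PropagatorsII, (2.51)–(2.56) pp.232–233 + Lemma 2.1 (2.61) p.234] -/
theorem hdivDs_of_pinsR {R₁ R₂ : RegFamY d ℓ hd hL b₀ b₁ Mstar (Matrix (Fin N) (Fin N) ℂ)} {PX PY : MemberY d ℓ hd hL b₀ b₁ Mstar → Type} [∀ x, Fintype (PX x)] [∀ x, Fintype (PY x)]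
    (H : MemberY d ℓ hd hL b₀ b₁ Mstar → Prop)
    (bI : ∀ x : MemberY d ℓ hd hL b₀ b₁ Mstar, FBondY x.toKIdx → IBondY x.toKIdx)
    (hβ1 : ∀ (x : MemberY d ℓ hd hL b₀ b₁ Mstar) (f : FBondY x.toKIdx), (geomT x.D).dist (β x.hN x.D x.hk (bI x f)) (blkV1 x.hN x.D f) ≤ 1)
    (𝔭A : ∀ x : MemberY d ℓ hd hL b₀ b₁ Mstar, HolderProbes (geo9Y x) (bg9YR (Matrix (Fin N) (Fin N) ℂ) (specialUnitaryUnits (Fin N)) R₁ R₂ x) (XBK (TrIdx N) x.toKIdx)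
      (XBK (TrIdx N) x.toKIdx) (PX x) (PY x))
    (Dd Dds : ∀ x : MemberY d ℓ hd hL b₀ b₁ Mstar, (bg9YR (Matrix (Fin N) (Fin N) ℂ) (specialUnitaryUnits (Fin N)) R₁ R₂ x).Cfg → Fin (d + 1) →
      Module.End ℝ (XBK (TrIdx N) x.toKIdx → ℝ))
    (hDd : ∀ (x : MemberY d ℓ hd hL b₀ b₁ Mstar) (U : (bg9YR (Matrix (Fin N) (Fin N) ℂ) (specialUnitaryUnits (Fin N)) R₁ R₂ x).Cfg),
      Dd x U = fun μ => coordOpK (trBasis N) (fun _ : Fin (d + 1) => cdBₗ x.toKIdx U μ))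
    (bHXA : ∀ x : MemberY d ℓ hd hL b₀ b₁ Mstar, ℝ → BlockNorm (toB6 (geo9Y x) 1 (H x)) ((XBK (TrIdx N) x.toKIdx) → ℝ))
    (hbHXA : ∀ x : MemberY d ℓ hd hL b₀ b₁ Mstar, bHXA x = fun ε =>
      letI : Fintype (B9GeoNormsKLevelV1.geo9K x.toKIdx).Site := (inferInstance : Fintype (geo9Y x).Site); bHK x.toKIdx (bI x) ε)
    (𝔬12 : ∀ x : MemberY d ℓ hd hL b₀ b₁ Mstar, B9Thm312Whole.Ops (geo9Y x) (bg9YR (Matrix (Fin N) (Fin N) ℂ) (specialUnitaryUnits (Fin N)) R₁ R₂ x)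
      (XBK (TrIdx N) x.toKIdx) (XBK (TrIdx N) x.toKIdx) (XHK (TrIdx N) x.toKIdx) (XSK (TrIdx N) x.toKIdx))
    (hblk12 : ∀ x : MemberY d ℓ hd hL b₀ b₁ Mstar, (𝔬12 x).blk = blkBK x.toKIdx (bI x))
    (hblkW12 : ∀ x : MemberY d ℓ hd hL b₀ b₁ Mstar, (𝔬12 x).blkW = blkSK x.toKIdx (sIK x.toKIdx (bI x)))
    (hDvsco12 : ∀ (x : MemberY d ℓ hd hL b₀ b₁ Mstar) (U : (bg9YR (Matrix (Fin N) (Fin N) ℂ) (specialUnitaryUnits (Fin N)) R₁ R₂ x).Cfg),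
      (𝔬12 x).Dvstar U = DvscoKH x.toKIdx (trBasis N) (bg9YR (Matrix (Fin N) (Fin N) ℂ) (specialUnitaryUnits (Fin N)) R₁ R₂ x) (fun U => U) U)
    {B12₀ δ12₀ M₀ a₀ c35 : ℝ} {Bh12 Bi12 : ℝ → ℝ} {Bi2₁₂ : ℝ → ℝ → ℝ}
    (hBi12 : ∀ ε, 0 < ε → ε ≤ 1 → 0 ≤ Bi12 ε) (hδ12₀ : 0 ≤ δ12₀)
    -- RULING-2 (c): dag-n06-w5's `h44Ds_pins` reads the (3.35) class of `U` (contracting transporters) — ONE displayed class-content hypothesis: the R-class lies in MODULE 3's class at the same constant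
    (hY335 : ∀ (x : MemberY d ℓ hd hL b₀ b₁ Mstar) (α₀ : ℝ) (U : (bg9YR (Matrix (Fin N) (Fin N) ℂ) (specialUnitaryUnits (Fin N)) R₁ R₂ x).Cfg), (bg9YR (Matrix (Fin N) (Fin N) ℂ) (specialUnitaryUnits (Fin N)) R₁ R₂ x).Reg335 c35 α₀ U → (bg9Y (Matrix (Fin N) (Fin N) ℂ) (specialUnitaryUnits (Fin N)) x).Reg335 c35 α₀ U)
    (h33 : ∀ x : MemberY d ℓ hd hL b₀ b₁ Mstar, M₀ ≤ (geo9Y x).M → ∀ α₀ : ℝ, 0 < α₀ → (geo9Y x).M * α₀ ≤ a₀ →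
      ∀ U : (bg9YR (Matrix (Fin N) (Fin N) ℂ) (specialUnitaryUnits (Fin N)) R₁ R₂ x).Cfg,
        (bg9YR (Matrix (Fin N) (Fin N) ℂ) (specialUnitaryUnits (Fin N)) R₁ R₂ x).Reg335 c35 α₀ U →
        (bg9YR (Matrix (Fin N) (Fin N) ℂ) (specialUnitaryUnits (Fin N)) R₁ R₂ x).Reg336 c35 α₀ U →
          Thm33G0Dir (𝔬12 x) (𝔭A x) (Dd x) (Dds x) 1 (H x) (bHXA x) B12₀ Bh12 Bi12 Bi2₁₂ δ12₀ U) :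
    ∃ (MD : ℝ) (BiD : ℝ → ℝ), (∀ ε, 0 < ε → 0 ≤ BiD ε) ∧
      ∀ x : MemberY d ℓ hd hL b₀ b₁ Mstar, MD ≤ (geo9Y x).M → ∀ α₀ : ℝ, 0 < α₀ → (geo9Y x).M * α₀ ≤ a₀ →
        ∀ U : (bg9YR (Matrix (Fin N) (Fin N) ℂ) (specialUnitaryUnits (Fin N)) R₁ R₂ x).Cfg,
          (bg9YR (Matrix (Fin N) (Fin N) ℂ) (specialUnitaryUnits (Fin N)) R₁ R₂ x).Reg335 c35 α₀ U →
          (bg9YR (Matrix (Fin N) (Fin N) ℂ) (specialUnitaryUnits (Fin N)) R₁ R₂ x).Reg336 c35 α₀ U →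
            ∀ (μ : Fin (d + 1)) (ε : ℝ), 0 < ε →
              HasMaj (bHXA x ε) (cNormR 1 (H x) (𝔬12 x).blkW (fun y => (geo9Y_len_pos x y).le) 0)
                ((𝔬12 x).Dvstar U ∘ₗ ((𝔬12 x).G0 U ∘ₗ Dds x U μ)) (fun a b => BiD ε * Real.exp (-(δ12₀ * (geo9Y x).dist a b))) := by
  -- [4] (2.61) at rate 1 above ONE threshold, constant floored at 0
  obtain ⟨ML, c₁, hrow⟩ := rowSum261_geo9Y (d := d) (ℓ := ℓ) (hd := hd) (hL := hL) (b₀ := b₀) (b₁ := b₁) (Mstar := Mstar) 1 one_pos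
  refine ⟨max M₀ ML, fun ε => (Fintype.card (Fin (d + 1)) : ℝ) * (cR39 (trBasis N) * Real.exp ((δ12₀ + 1) * rJ d ℓ) * Bi12 (min ε 1) * max c₁ 0),
    fun ε hε => mul_nonneg (Nat.cast_nonneg _) (mul_nonneg (mul_nonneg (mul_nonneg (cR39_nonneg _) (Real.exp_nonneg _))
      (hBi12 (min ε 1) (lt_min hε one_pos) (min_le_right _ _))) (le_max_right _ _)), fun x hM α₀ hα ha U hU hU' μ ε hε => ?_⟩
  have hrowx : RowSum (toB6 (geo9Y x) 1 (H x)) 1 (max c₁ 0) := fun y => (hrow x ((le_max_right _ _).trans hM) y).trans (le_max_left _ _)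
  -- dag-n06-w5's Y-face consumed UNCHANGED at the fieldwise re-typings `ops312RY ∕ holderProbesRY` (`B9OpsRTransport`), the G₀-layer input carried over by `thm33G0Dir_iff`
  have h33' := h33 x ((le_max_left _ _).trans hM) α₀ hα ha U hU hU'
  rw [← thm33G0Dir_iff] at h33'
  exact h44Ds_pins x (hβ1 x) (𝔬 := ops312RY (𝔬12 x)) (𝔭 := holderProbesRY (𝔭A x)) (Dd := Dd x) (Dds := Dds x) (hY335 x α₀ U hU) (hbHXA x) hrowx (le_max_right _ _) hBi12 hδ12₀
    le_rfl (δJ := δ12₀ + 1) (by linarith only [hδ12₀]) (by linarith only) (hblk12 x) (hblkW12 x) (hDvsco12 x U) (hDd x U) h33' μ ε hε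

end Summit.QuantumFields.YangMills.BalabanUVNodes.N06DivLegAtPinsPhysR

end
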